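import Summits.RiemannHypothesis.RiemannHypothesis.Theorems.PfPersistenceM2EvenSectorAnnihilation
import Summits.RiemannHypothesis.RiemannHypothesis.Theorems.PfPersistenceM2EvenSectorIndexDichotomy
import HarnessLib

/-!
# PF-persistence, M2 seat (gen 6), part 5/5: the annihilation hypothesis holds for finitely many zeros, needs
# only a NON-ZERO value (phase lemma), and under it the even negative index on long windows is `K` for every
# `K ∈ ℕ ∪ {∞}`; the trichotomy's residue becomes "some infinite `𝒵_θ` is not annihilable"

pub-rhpf cell, M2 seat, generation 6.  HONEST FRAMING (page 1 of everything in this cell): a long-odds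
MECHANISM SEARCH around Weil's quadratic functional; NOTHING here claims, approaches or conditionally proves RH.
Labels: PROVED = kernel-checked; CITED = in print; HYPOTHESIS = an explicit binder; DERIVED = paper level, NOT
kernel-checked, never used as a fact.  Notation as in part 4 (`𝒵_θ`, `𝒬`, `K`, `Q`, `ĝ`; (QA_θ) =
`QuadrantAnnihilable θ`).

PROVED here (RH-free):
* `quadrantAnnihilable_of_finite` — (QA_θ) holds when `𝒵_θ` is finite (gen-5 interpolation
  `exists_evenRealTest_weilMellin_eq`); so part 2's theorem is the finite case of part 4's; `QuadrantAnnihilable.mono`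
  — (QA_θ) is monotone in `θ`.
* `im_coshFactor`, `quadrantAnnihilable_of_ne_zero` — PHASE LEMMA: it suffices to separate `e` from `𝒵_θ ∖ {e}`
  by an even real test with `φ̂(e) ≠ 0` (any non-zero complex value): a real combination of `φ` and its symmetric
  translate by `1/γ_e` (factor `cosh(δ/γ) cos 1 + i sinh(δ/γ) sin 1`, of non-zero imaginary part) realises the
  value `i` while keeping the zeros.
* `evenNegIndexAtLeast_of_annihilable` — `θ > 0`, (QA_θ), `n ≤ #𝒵_θ` ⟹ even negative index `≥ n` on all long
  windows; `encard_le_or_exists_not_annihilable` — THE TRICHOTOMY SHARPENED: no window with `n + 1` independent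
  negative even directions ⟹ `K ≤ n` OR some `𝒵_θ` (`θ > 0`) is infinite AND not annihilable;
  `exists_evenNegIndexAtLeast_iff_of_annihilable` / `forall_not_evenNegIndexAtLeast_succ_iff_of_annihilable` —
  under `∀ θ > 0, (QA_θ)`: `(∃ a, EvenNegIndexAtLeast n a) ↔ n ≤ K` and `L_n^{ev} ↔ K ≤ n` for EVERY `n` and every
  `K ∈ ℕ ∪ {∞}` (with gen 4's upper bound the even index on long windows is `K` exactly).

STATUS OF (QA_θ) FOR INFINITE `𝒵_θ` (DERIVED — paper level, recorded for the cell's ledger, NOT kernel-checked,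
never invoked): the separating test exists by classical analysis with no arithmetic input beyond a zero-density
estimate.  Sketch: by Carlson's density theorem `N(σ, T) = O(T^{4σ(1-σ)+ε})` for fixed `1/2 < σ < 1` (CITED:
Titchmarsh–Heath-Brown, *The theory of the Riemann zeta-function*, 2nd ed., Thm 9.17; Thms 9.18–9.19 improve the
exponent) the ordinates of `𝒵_θ` have convergence exponent `c = c(θ) < 1` (while ALL zeros have exponent `1` with
a logarithm to spare — which is why no compactly supported test annihilates every zero); the even canonical product
`F(s) = Π_{ρ ∈ 𝒵_θ∖{e}} (1 - (s-½)²/(ρ-½)²)(1 - (s-½)²/(ρ̄-½)²)` is entire of order `≤ c` in `w = s - ½`, even in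
`w`, with real Taylor coefficients `a_m` (of `w^{2m}`), vanishing exactly on the quadruples of `𝒵_θ ∖ {e}` (CITED:
Boas, *Entire functions*, Thm 2.6.5 — the order of a canonical product is the convergence exponent, Def. 2.5.2, of
its zeros — and Thm 2.2.10, coefficients vs growth: `|a_m| ≤ (C/2m)^{2m/c'}` for any `c' ∈ (c, 1)`); for a
compactly supported even real GEVREY bump `ψ` of class `σ ∈ (1, 1/c')` (CITED: Hörmander, *ALPDO I*, Thm 1.3.5 with
`a_j = a(j+1)^{-σ}/ζ(σ)`, giving `|ψ^{(k)}| ≤ C^{k+1}(k!)^σ` on a support of length `a`, symmetrised; such classes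
are non-quasi-analytic by Thm 1.3.8, Denjoy–Carleman) the infinite-order operator
`φ := F(d/dt)ψ = Σ_m a_m ψ^{(2m)}` converges with all derivatives (`m`-th term of the `j`-th derivative
`≤ C_j (C (2m)^{σ - 1/c'})^{2m}`, and `σ < 1/c'`), so `φ` is smooth, even, real, `supp φ ⊆ supp ψ`, and termwise
integration by parts gives `φ̂(w) = Σ a_m w^{2m} ψ̂(w) = F · ψ̂`; hence `φ̂ = 0` on `𝒵_θ ∖ {e}` and, after a
dilation of `ψ` moving the discrete zero set of `ψ̂` off `e`, `φ̂(e) ≠ 0`; the phase lemma below then gives the value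
`i`.  A Lean proof would need a zero-density estimate as a named Literature fact, canonical products of order `< 1`
with coefficient bounds, and Gevrey cut-offs with factorial-power derivative bounds — none in Mathlib today; until
then (QA_θ) is an explicit binder and the cell's tables list the `K = ∞` case as "PROVED modulo (QA), (QA) DERIVED".
[CITED shape of the count: Bombieri 2000, Rend. Lincei (9) 11, Thm 9 (even part) / Thm 11 / Corollary p. 217 —
there for truncations and finitely many off-line zeros; the third alternative of that Corollary (linear dependence
of the `x^{-ρ}` over a fixed `E`) has no analogue here because the windows grow.]
-/

noncomputable section

set_option linter.dupNamespace false

open Complex Filter Set MeasureTheory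
open scoped Real Topology ComplexConjugate BigOperators

namespace Summit.RiemannHypothesis.RiemannHypothesis.Theorems.PfPersistenceM2NegIndex

open Literature.NumberTheory.LFunctions
open Literature.NumberTheory.LFunctions.WeilConverse
open Literature.NumberTheory.LFunctions.ZetaZeros
open Summit.RiemannHypothesis.RiemannHypothesis.Theorems.RuelleBandExactFirstBand
  (isWeilTest_symTranslate symTranslate_even symTranslate_im weilMellin_symTranslate)

/-! ## J. (QA_θ) for finitely many zeros; the phase lemma -/

/-- (QA_θ) holds when only finitely many zeros have `Re ρ ≥ 1/2 + θ`, `Im ρ > 0`: interpolate `i·[ρ = e]` on that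
finite set by an even real test in `[-1, 1]` (gen 5, `exists_evenRealTest_weilMellin_eq`).  Hence part 2's
`exists_negative_definite_even_family_of_finite_above` is the finite case of part 4. [folklore] -/
theorem quadrantAnnihilable_of_finite {θ : ℝ} (hθ : 0 < θ)
    (hfin : {ρ : ℂ | ρ ∈ riemannZetaNontrivialZeros ∧ 1 / 2 + θ ≤ ρ.re ∧ 0 < ρ.im}.Finite) :
    QuadrantAnnihilable θ := by
  classical
  intro e he
  have hZq : ∀ ρ ∈ hfin.toFinset, 1 / 2 < ρ.re ∧ 0 < ρ.im := fun ρ hρ ↦ by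
    have h := hfin.mem_toFinset.1 hρ
    exact ⟨by linarith [h.2.1], h.2.2⟩
  obtain ⟨φ, hφt, hφe, hφr, hφs, hφv⟩ :=
    exists_evenRealTest_weilMellin_eq hfin.toFinset hZq fun ρ ↦ if ρ = e then I else 0
  refine ⟨φ, 1, hφt, hφe, hφr, hφs, ?_, fun ρ hρ hne ↦ ?_⟩
  · rw [hφv e (hfin.mem_toFinset.2 he), if_pos rfl]
  · rw [hφv ρ (hfin.mem_toFinset.2 hρ), if_neg hne]

/-- (QA_θ) is monotone in `θ`: a separating test for `e` against `𝒵_θ ∖ {e}` also separates it against the smaller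
`𝒵_θ' ∖ {e}`, `θ ≤ θ'`.  So `∀ θ > 0, (QA_θ)` only concerns arbitrarily small `θ`. [folklore] -/
theorem QuadrantAnnihilable.mono {θ θ' : ℝ} (hθ : θ ≤ θ') (hann : QuadrantAnnihilable θ) :
    QuadrantAnnihilable θ' := by
  intro e he
  obtain ⟨φ, b, hφt, hφe, hφr, hφs, hφv, hφ0⟩ := hann e ⟨he.1, by linarith [he.2.1], he.2.2⟩
  exact ⟨φ, b, hφt, hφe, hφr, hφs, hφv, fun ρ hρ hne ↦ hφ0 ρ ⟨hρ.1, by linarith [hρ.2.1], hρ.2.2⟩ hne⟩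

/-- The imaginary part of the transform factor of a symmetric translate: `Im cosh((s - 1/2)T) =
sinh((Re s - 1/2)T)·sin(Im s·T)`. [folklore] -/
theorem im_coshFactor (s : ℂ) (T : ℝ) :
    ((cexp ((s - 1 / 2) * T) + cexp (-((s - 1 / 2) * T))) / 2).im =
      Real.sinh ((s.re - 1 / 2) * T) * Real.sin (s.im * T) := by
  have hre : ((s - 1 / 2) * (T : ℂ)).re = (s.re - 1 / 2) * T := by simp [Complex.mul_re]
  have him : ((s - 1 / 2) * (T : ℂ)).im = s.im * T := by simp [Complex.mul_im]
  have h1 : (cexp ((s - 1 / 2) * T)).im = Real.exp ((s.re - 1 / 2) * T) * Real.sin (s.im * T) := by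
    rw [Complex.exp_im, hre, him]
  have h2 : (cexp (-((s - 1 / 2) * T))).im = -(Real.exp (-((s.re - 1 / 2) * T)) * Real.sin (s.im * T)) := by
    rw [Complex.exp_im, Complex.neg_re, Complex.neg_im, hre, him, Real.sin_neg, mul_neg]
  have h3 : (cexp ((s - 1 / 2) * T) + cexp (-((s - 1 / 2) * T))) / 2 =
      (((1 / 2 : ℝ)) : ℂ) * (cexp ((s - 1 / 2) * T) + cexp (-((s - 1 / 2) * T))) := by
    push_cast
    ring
  rw [h3, Complex.im_ofReal_mul, Complex.add_im, h1, h2, Real.sinh_eq]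
  ring

/-- **PHASE LEMMA.**  To verify (QA_θ) it suffices to separate each `e ∈ 𝒵_θ` from `𝒵_θ ∖ {e}` by an even,
real-valued, compactly supported Weil test with `φ̂(e) ≠ 0` (any non-zero value): with `T = 1/γ_e` the symmetric
translate `ψ = (φ(· - T) + φ(· + T))/2` has `ψ̂ = φ̂ · ch`, `Im ch(e) = sinh(δ_e/γ_e) sin 1 > 0` (`im_coshFactor`),
so a REAL combination `a φ + b ψ` takes the value `i` at `e` and still vanishes on `𝒵_θ ∖ {e}`.  (This is the
form in which the DERIVED construction of the module docstring delivers (QA_θ).) [folklore] -/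
theorem quadrantAnnihilable_of_ne_zero {θ : ℝ} (hθ : 0 < θ)
    (h : ∀ e ∈ {ρ : ℂ | ρ ∈ riemannZetaNontrivialZeros ∧ 1 / 2 + θ ≤ ρ.re ∧ 0 < ρ.im},
      ∃ φ : ℝ → ℂ, ∃ b : ℝ, IsWeilTest φ ∧ (∀ t : ℝ, φ (-t) = φ t) ∧ (∀ t : ℝ, (φ t).im = 0) ∧
        tsupport φ ⊆ Icc (-b) b ∧ weilMellin φ e ≠ 0 ∧
        ∀ ρ ∈ {ρ : ℂ | ρ ∈ riemannZetaNontrivialZeros ∧ 1 / 2 + θ ≤ ρ.re ∧ 0 < ρ.im}, ρ ≠ e →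
          weilMellin φ ρ = 0) :
    QuadrantAnnihilable θ := by
  intro e he
  obtain ⟨φ, b, hφt, hφe, hφr, hφs, hφne, hφ0⟩ := h e he
  have hγ : 0 < e.im := he.2.2
  have hδ : 0 < e.re - 1 / 2 := by linarith [he.2.1]
  -- the symmetric translate by `T = 1/γ`
  set T : ℝ := 1 / e.im with hTdef
  have hTpos : 0 < T := by simp only [hTdef]; positivity
  set ψ : ℝ → ℂ := fun t ↦ (φ (t - T) + φ (t + T)) / 2 with hψdef
  have hψt : IsWeilTest ψ := isWeilTest_symTranslate hφt T
  have hψe : ∀ t : ℝ, ψ (-t) = ψ t := fun t ↦ symTranslate_even hφe T t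
  have hψr : ∀ t : ℝ, (ψ t).im = 0 := fun t ↦ symTranslate_im hφr T t
  have hψs : tsupport ψ ⊆ Icc (-(b + T)) (b + T) := tsupport_symTranslate_subset hφs hTpos.le
  have hψm : ∀ s : ℂ, weilMellin ψ s =
      weilMellin φ s * ((cexp ((s - 1 / 2) * T) + cexp (-((s - 1 / 2) * T))) / 2) :=
    fun s ↦ weilMellin_symTranslate hφt T s
  set ch : ℂ := (cexp ((e - 1 / 2) * T) + cexp (-((e - 1 / 2) * T))) / 2 with hchdef
  have hchim : 0 < ch.im := by
    rw [hchdef, im_coshFactor]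
    have h1 : e.im * T = 1 := by rw [hTdef]; field_simp
    rw [h1]
    exact mul_pos (Real.sinh_pos_iff.2 (mul_pos hδ hTpos))
      (Real.sin_pos_of_pos_of_lt_pi one_pos (by linarith [Real.pi_gt_three]))
  -- real `a`, `b'` with `(a + b' ch) φ̂(e) = i`
  set w : ℂ := I / weilMellin φ e with hwdef
  set b' : ℝ := w.im / ch.im with hb'def
  set a : ℝ := w.re - b' * ch.re with hadef
  have hab : (a : ℂ) + (b' : ℂ) * ch = w := by
    apply Complex.ext
    · simp [hadef, Complex.mul_re]
    · simp only [Complex.add_im, Complex.ofReal_im, Complex.mul_im, Complex.ofReal_re, zero_mul, add_zero,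
        zero_add, hb'def]
      exact div_mul_cancel₀ _ hchim.ne'
  have h1t : IsWeilTest fun t ↦ (a : ℂ) * φ t := hφt.const_mul a
  have h2t : IsWeilTest fun t ↦ (b' : ℂ) * ψ t := hψt.const_mul b'
  set χ : ℝ → ℂ := (fun t ↦ (a : ℂ) * φ t) + fun t ↦ (b' : ℂ) * ψ t with hχdef
  have hχm : ∀ s : ℂ, weilMellin χ s = (a : ℂ) * weilMellin φ s + (b' : ℂ) * weilMellin ψ s := fun s ↦ by
    rw [hχdef, weilMellin_add h1t.1.continuous h1t.2 h2t.1.continuous h2t.2, weilMellin_const_mul,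
      weilMellin_const_mul]
  refine ⟨χ, b + T, h1t.add h2t, fun t ↦ ?_, fun t ↦ ?_, ?_, ?_, fun ρ hρ hne ↦ ?_⟩
  · show (a : ℂ) * φ (-t) + (b' : ℂ) * ψ (-t) = (a : ℂ) * φ t + (b' : ℂ) * ψ t
    rw [hφe, hψe]
  · show ((a : ℂ) * φ t + (b' : ℂ) * ψ t).im = 0
    simp [Complex.mul_im, hφr t, hψr t]
  · have hsub : tsupport χ ⊆ tsupport (fun t ↦ (a : ℂ) * φ t) ∪ tsupport (fun t ↦ (b' : ℂ) * ψ t) :=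
      tsupport_add _ _
    refine hsub.trans (union_subset (tsupport_mul_subset_right.trans (hφs.trans (Icc_subset_Icc ?_ ?_)))
      (tsupport_mul_subset_right.trans hψs)) <;> linarith
  · rw [hχm, hψm e, ← hchdef]
    calc (a : ℂ) * weilMellin φ e + (b' : ℂ) * (weilMellin φ e * ch)
        = ((a : ℂ) + (b' : ℂ) * ch) * weilMellin φ e := by ring
      _ = I := by rw [hab, hwdef, div_mul_cancel₀ _ hφne]
  · rw [hχm, hψm ρ, hφ0 ρ hρ hne, zero_mul, mul_zero, mul_zero, add_zero]

/-! ## K. The even negative index under (QA): `= K` for every `K ∈ ℕ ∪ {∞}`; the residue re-typed -/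

/-- Part 4 repackaged: `θ > 0`, (QA_θ), `n ≤ #𝒵_θ` (in `ℕ∞`) ⟹ even negative index `≥ n` on ALL sufficiently long
windows. [cite: Bombieri2000Weil, Thm 9 (even part); Thm 11] -/
theorem evenNegIndexAtLeast_of_annihilable {θ : ℝ} (hθ : 0 < θ) (hann : QuadrantAnnihilable θ) {n : ℕ}
    (hn : (n : ℕ∞) ≤ {ρ : ℂ | ρ ∈ riemannZetaNontrivialZeros ∧ 1 / 2 + θ ≤ ρ.re ∧ 0 < ρ.im}.encard) :
    ∃ A : ℝ, ∀ a : ℝ, A ≤ a → EvenNegIndexAtLeast n a := by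
  obtain ⟨A, g, h1, h2, h3, h4, h5⟩ := exists_negative_definite_even_family_of_annihilable hθ hann hn
  exact ⟨A, fun a ha ↦ EvenNegIndexAtLeast.mono ⟨g, h1, h2, h3, h4, h5⟩ ha⟩

/-- **THE TRICHOTOMY, SHARPENED (RH-free, no hypothesis).**  If no window carries `n + 1` independent negative even
directions, then EITHER `K ≤ n` OR for some `θ > 0` the set `𝒵_θ` is infinite AND NOT annihilable.  (Part 3 had
"`K ≤ n` or some `𝒵_θ` infinite"; the second alternative now also requires the failure of (QA_θ), which is DERIVED
to be impossible — module docstring — but not kernel-checked.) [cite: Bombieri2000Weil, Thm 9 (even part); Thm 11] -/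
theorem encard_le_or_exists_not_annihilable (n : ℕ) (hno : ∀ a : ℝ, ¬ EvenNegIndexAtLeast (n + 1) a) :
    {ρ : ℂ | ρ ∈ riemannZetaNontrivialZeros ∧ 1 / 2 < ρ.re ∧ 0 < ρ.im}.encard ≤ n ∨
      ∃ θ : ℝ, 0 < θ ∧ {ρ : ℂ | ρ ∈ riemannZetaNontrivialZeros ∧ 1 / 2 + θ ≤ ρ.re ∧ 0 < ρ.im}.Infinite ∧
        ¬ QuadrantAnnihilable θ := by
  rcases encard_le_or_infinite_above n hno with hle | ⟨θ, hθ, hinf⟩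
  · exact Or.inl hle
  · refine Or.inr ⟨θ, hθ, hinf, fun hann ↦ ?_⟩
    obtain ⟨A, hA⟩ := evenNegIndexAtLeast_of_annihilable hθ hann (n := n + 1)
      (by rw [hinf.encard_eq]; exact le_top)
    exact hno A (hA A le_rfl)

/-- Under (QA) at every distance: `n + 1` off-line quadruples (any `K ∈ ℕ ∪ {∞}`) force `n + 1` independent negative
even directions on some window. [cite: Bombieri2000Weil, Thm 9 (even part)] -/
theorem exists_evenNegIndexAtLeast_succ_of_lt_encard_of_annihilable (n : ℕ)
    (hann : ∀ θ : ℝ, 0 < θ → QuadrantAnnihilable θ)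
    (hK : (n : ℕ∞) < {ρ : ℂ | ρ ∈ riemannZetaNontrivialZeros ∧ 1 / 2 < ρ.re ∧ 0 < ρ.im}.encard) :
    ∃ a : ℝ, EvenNegIndexAtLeast (n + 1) a := by
  by_contra hno
  rw [not_exists] at hno
  rcases encard_le_or_exists_not_annihilable n hno with hle | ⟨θ, hθ, _, hnot⟩
  · exact absurd hK (not_lt.2 hle)
  · exact hnot (hann θ hθ)

/-- **The even negative index under (QA), every `K ∈ ℕ ∪ {∞}`.**  HYPOTHESIS: (QA_θ) for every `θ > 0`.  Then for
EVERY `n`: `(∃ a, EvenNegIndexAtLeast n a) ↔ n ≤ K` — with gen 4's `le_encard_quadrant_of_evenNegIndexAtLeast`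
the even negative index on long windows is `min(n, K)`-saturating, i.e. exactly `K`, finite or not.
[cite: Bombieri2000Weil, Thm 9 (even part)] -/
theorem exists_evenNegIndexAtLeast_iff_of_annihilable (hann : ∀ θ : ℝ, 0 < θ → QuadrantAnnihilable θ) (n : ℕ) :
    (∃ a : ℝ, EvenNegIndexAtLeast n a) ↔
      (n : ℕ∞) ≤ {ρ : ℂ | ρ ∈ riemannZetaNontrivialZeros ∧ 1 / 2 < ρ.re ∧ 0 < ρ.im}.encard := by
  constructor
  · rintro ⟨a, ha⟩
    exact le_encard_quadrant_of_evenNegIndexAtLeast ha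
  · intro hn
    cases n with
    | zero => exact ⟨0, evenNegIndexAtLeast_zero 0⟩
    | succ k =>
      refine exists_evenNegIndexAtLeast_succ_of_lt_encard_of_annihilable k hann (lt_of_lt_of_le ?_ hn)
      exact_mod_cast Nat.lt_succ_self k

/-- Under (QA): `K = ∞` ⟹ the even negative index on long windows is UNBOUNDED (every level is eventually
negative somewhere). [cite: Bombieri2000Weil, Thm 9 (even part)] -/
theorem forall_exists_evenNegIndexAtLeast_of_infinite_of_annihilable
    (hann : ∀ θ : ℝ, 0 < θ → QuadrantAnnihilable θ)
    (hinf : {ρ : ℂ | ρ ∈ riemannZetaNontrivialZeros ∧ 1 / 2 < ρ.re ∧ 0 < ρ.im}.Infinite) (n : ℕ) :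
    ∃ a : ℝ, EvenNegIndexAtLeast n a :=
  (exists_evenNegIndexAtLeast_iff_of_annihilable hann n).2 (by rw [hinf.encard_eq]; exact le_top)

/-- **The level-sign hierarchy under (QA), residue-free in `K`.**  HYPOTHESIS: (QA_θ) for every `θ > 0`.  Then for
EVERY `n`: "the `(n+1)`-st even level is `≥ 0` at every window" (`L_n^{ev}`) ⟺ `K ≤ n`, whatever `K ∈ ℕ ∪ {∞}`;
in particular `K = ∞` makes every `L_n^{ev}` false.  Only `n = 0` (even Weil positivity ⟺ `K = 0`) is RH-strength.
[cite: Bombieri2000Weil, Thm 9 (even part)] -/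
theorem forall_not_evenNegIndexAtLeast_succ_iff_of_annihilable
    (hann : ∀ θ : ℝ, 0 < θ → QuadrantAnnihilable θ) (n : ℕ) :
    (∀ a : ℝ, ¬ EvenNegIndexAtLeast (n + 1) a) ↔
      {ρ : ℂ | ρ ∈ riemannZetaNontrivialZeros ∧ 1 / 2 < ρ.re ∧ 0 < ρ.im}.encard ≤ n := by
  constructor
  · intro hno
    rcases encard_le_or_exists_not_annihilable n hno with hle | ⟨θ, hθ, _, hnot⟩
    · exact hle
    · exact absurd (hann θ hθ) hnot
  · intro hle a ha
    have h := le_encard_quadrant_of_evenNegIndexAtLeast ha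
    have h2 : ((n + 1 : ℕ) : ℕ∞) ≤ (n : ℕ∞) := h.trans hle
    exact absurd (by exact_mod_cast h2 : n + 1 ≤ n) (Nat.not_succ_le_self n)

end Summit.RiemannHypothesis.RiemannHypothesis.Theorems.PfPersistenceM2NegIndex

end
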